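import Mathlib

/-!
# SoloBlind E61 — the pairing lemma behind THEOREM H1 (solo-Langlands-blind, s120)

Informal THEOREM H1 (HOME `work/s117/tower_theory.md` §16, "Shimura-covering index theorem").
For `ℓ ≥ 5`, primes `p ≠ q` with `ℓ ∤ pq`, `a_p = v_ℓ(p-1) ≥ 1`, `a_q = v_ℓ(q-1)`, the `(+,+)`
Eisenstein depth of the `q`-new Hecke algebra of level `pq` is
`length (T^{q-new}(pq)_𝔫 / I) = a_q + ι_p(q)`, `ι_p(q) = v_ℓ[((ℤ/p)ˣ)_ℓ : ⟨q⟩]`.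
Step 3 of the proof transports the perfect, alternating, Hecke-hermitian pairing on
`J₀(p)_𝔪[η_q]` to a perfect alternating pairing `B` on `J₀(p)[𝓘]_ℓ = C ⊕ Σ` (cuspidal ⊕ Shimura,
both cyclic of order `ℓ^{a_p}`) and uses the following piece of finite group theory, checked here
for an arbitrary biadditive pairing `B : G →+ G →+ A` with `B x x = 0` and trivial left kernel on a
group `G` generated by two elements `c, s`:

* `alt_isotropic` — every cyclic subgroup is isotropic: `B (i•c) (j•c) = 0`;
* `pair_with_gen` — for `y = a•c + b•s` the character `k•s ↦ B y (k•s)` of `⟨s⟩` only sees the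
  `c`-component: `B y (k•s) = B (a•c) (k•s)`;
* `cComponent_eq_zero` — that character is trivial only if `a•c = 0` (so `B : ⟨c⟩ × ⟨s⟩ → A` is
  left-nondegenerate);
* `character_killed_iff` — hence `n` kills the character `σ ↦ B y σ` on `⟨s⟩` iff `n` kills the
  `c`-component `a•c` of `y`: the ORDER of the character equals the order of `y_C`
  (tower §16.3 (iii)–(iv): `ord(e(x,·)|_Σ) = ord(pr_C(θ_q x))`, which gives
  `μ^{q-new} = m - log_ℓ ord(b̄)` with no injectivity hypothesis on `θ_q`).
-/

namespace Summit.Langlands.Langlands.Theorems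

section AlternatingPairing

variable {G A : Type*} [AddCommGroup G] [AddCommGroup A]

/-- An alternating biadditive pairing is skew: `B x y = - B y x`. -/
theorem alt_skew (B : G →+ G →+ A) (halt : ∀ x, B x x = 0) (x y : G) :
    B x y = -B y x := by
  have h := halt (x + y)
  simp only [map_add, AddMonoidHom.add_apply, halt, zero_add, add_zero] at h
  exact eq_neg_of_add_eq_zero_right h

/-- Every cyclic subgroup is isotropic for an alternating pairing. -/
theorem alt_isotropic (B : G →+ G →+ A) (halt : ∀ x, B x x = 0) (c : G) (i j : ℤ) :
    B (i • c) (j • c) = 0 := by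
  simp [map_zsmul, halt]

/-- For `y = a•c + b•s`, pairing `y` against multiples of `s` only sees the `c`-component of `y`. -/
theorem pair_with_gen (B : G →+ G →+ A) (halt : ∀ x, B x x = 0) (c s y : G) (a b k : ℤ)
    (hy : y = a • c + b • s) : B y (k • s) = B (a • c) (k • s) := by
  subst hy
  rw [map_add, AddMonoidHom.add_apply, alt_isotropic B halt s b k, add_zero]

/-- Left-nondegeneracy of `B` on `⟨c⟩ × ⟨s⟩`: if `B (j•c) ·` kills all multiples of `s`, then
`j•c = 0` (because it also kills `⟨c⟩` by isotropy, hence all of `G = ⟨c, s⟩`). -/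
theorem cComponent_eq_zero (B : G →+ G →+ A) (halt : ∀ x, B x x = 0)
    (hnd : ∀ x : G, (∀ y : G, B x y = 0) → x = 0) (c s : G)
    (hspan : ∀ g : G, ∃ a b : ℤ, g = a • c + b • s) (j : ℤ)
    (hj : ∀ k : ℤ, B (j • c) (k • s) = 0) : j • c = 0 := by
  apply hnd
  intro y
  obtain ⟨a, b, rfl⟩ := hspan y
  rw [map_add, alt_isotropic B halt c j a, hj b, add_zero]

/-- The order statement: `n` kills the character `k•s ↦ B (j•c) (k•s)` of `⟨s⟩` iff `n` kills `j•c`. -/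
theorem cCharacter_killed_iff (B : G →+ G →+ A) (halt : ∀ x, B x x = 0)
    (hnd : ∀ x : G, (∀ y : G, B x y = 0) → x = 0) (c s : G)
    (hspan : ∀ g : G, ∃ a b : ℤ, g = a • c + b • s) (j : ℤ) (n : ℕ) :
    (∀ k : ℤ, n • B (j • c) (k • s) = 0) ↔ n • (j • c) = 0 := by
  have key : ∀ k : ℤ, n • B (j • c) (k • s) = B (((n : ℤ) * j) • c) (k • s) := by
    intro k
    rw [mul_zsmul, natCast_zsmul, map_nsmul, AddMonoidHom.nsmul_apply]
  constructor
  · intro h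
    have h' : ((n : ℤ) * j) • c = 0 :=
      cComponent_eq_zero B halt hnd c s hspan ((n : ℤ) * j) (fun k => by rw [← key k]; exact h k)
    rwa [mul_zsmul, natCast_zsmul] at h'
  · intro h k
    rw [key k, mul_zsmul, natCast_zsmul, h, map_zero, AddMonoidHom.zero_apply]

/-- THE PAIRING LEMMA (tower §16.3): for `y = a•c + b•s`, the character `σ ↦ B y σ` on `⟨s⟩` is
killed by `n` iff the `c`-component `a•c` of `y` is; i.e. `ord(B(y,·)|_{⟨s⟩}) = ord(y_C)`. -/
theorem character_killed_iff (B : G →+ G →+ A) (halt : ∀ x, B x x = 0)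
    (hnd : ∀ x : G, (∀ y : G, B x y = 0) → x = 0) (c s : G)
    (hspan : ∀ g : G, ∃ a b : ℤ, g = a • c + b • s) (y : G) (a b : ℤ)
    (hy : y = a • c + b • s) (n : ℕ) :
    (∀ k : ℤ, n • B y (k • s) = 0) ↔ n • (a • c) = 0 := by
  rw [← cCharacter_killed_iff B halt hnd c s hspan a n]
  simp only [pair_with_gen B halt c s y a b _ hy]

/-- Symmetric-looking corollary used for THEOREM H1: the character is trivial iff `y ∈ ⟨s⟩`-component
only, i.e. `B y (k•s) = 0` for all `k` iff `a•c = 0`. -/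
theorem character_trivial_iff (B : G →+ G →+ A) (halt : ∀ x, B x x = 0)
    (hnd : ∀ x : G, (∀ y : G, B x y = 0) → x = 0) (c s : G)
    (hspan : ∀ g : G, ∃ a b : ℤ, g = a • c + b • s) (y : G) (a b : ℤ)
    (hy : y = a • c + b • s) :
    (∀ k : ℤ, B y (k • s) = 0) ↔ a • c = 0 := by
  have h := character_killed_iff B halt hnd c s hspan y a b hy 1
  simpa using h

end AlternatingPairing

end Summit.Langlands.Langlands.Theorems
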